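import Mathlib
import HarnessLib
import HarnessLib.Audit
import Summits.ValiantsHypothesis.Statement
import Literature.Computability.AlgebraicComplexity.DeterminantalComplexity
import HarnessLib.Audit.Status.Attr

/-!
Route: PrincipalMinorColouring

# Route PrincipalMinorColouring — one matrix and a colouring — the total rank of determinantal
expressions of per_n is not quasi-polynomial

PRINCIPAL-MINOR NORMAL FORM (card principal-minor-colouring, absorbing principal-minor-dodgson;
engine material of read-rank-conditioning).
By Sylvester's identity det(I_m + UDVᵀ) = det(I_R + DVᵀU), EVERY affine determinantal expression
per_n = det(A₀ + Σ_e y_e A_e), of any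
size m, becomes after the shift y = x + J (per_n(J) = n! ≠ 0, so A(J) is invertible) ONE square
matrix and a colouring:
per_n(x + J) = n! · det(I_R + diag(x_κ(1), …, x_κ(R)) · K), K ∈ ℂ^(R×R), κ : [R] → [n]², with
colour-class sizes |κ⁻¹(e)| = rank A_e and
R = Σ_e rank A_e =: the TOTAL RANK of the expression; the size m has disappeared. So pmc(per_n) :=
least such R = least total rank of a
determinantal expression of per_n, and dc ≤ pmc ≤ n²·dc (supports PMReprIsDetRepr, NormalForm,
TotalRankLeDc): the coefficients of
per_n(x+J)/n! — (n−|S|)!/n! on partial permutation matrices S, 0 elsewhere — must be the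
κ-aggregated principal minors Σ_(T: κ(T)=S) det K_T
of one matrix. X (target TotalRankNotQP): pmc(per_n) is not quasi-polynomially bounded — for every c
some n admits no principal-minor
representation of size ≤ 2^((log₂ n + c)^c). X is equivalent to route DetQP's DetqpThesis (the two
supports above), the novelty is the measure
and its ladder: the trivial bound is already pmc ≥ n² (every variable needs rank ≥ 1), det_n sits
exactly on it (pmc(det_n) = n², read-once),
Ikenmeyer–Landsberg give pmc(per_n) ≥ n² + 1 (n ≥ 3) and Grenet gives pmc(per_n) ≤ n·2^(n−1);
everything in between is open and is this
route's crux ladder (BoundedRankImpossible ⊂ TotalRankSuperlinear ⊂ X, plus the border/certificate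
form BorderBoundedRank).
Lean: `∀ c : ℕ, ∃ n : ℕ, ∀ R ≤ 2 ^ ((Nat.log 2 n + c) ^ c), ¬ ∃ (K : Matrix (Fin R) (Fin R) ℂ) (κ :
Fin R → Fin n × Fin n), MvPolynomial.aeval (fun e => MvPolynomial.X e + 1)
(Literature.Computability.AlgebraicComplexity.perPoly (Fin n) ℂ) = MvPolynomial.C (n.factorial : ℂ)
* (1 + Matrix.diagonal (fun i => MvPolynomial.X (κ i)) * K.map (fun a : ℂ => (MvPolynomial.C a :
MvPolynomial (Fin n × Fin n) ℂ))).det`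

## Assembly
Pure logic (checked sorry-free as `assembly_holds` in the planner's Sketch.lean): if dc(per_n) were
qp-bounded with constant c, QpArith gives
c', TotalRankNotQP gives an n with no representation of size ≤ 2^((log₂ n + c')^c'), while
TotalRankLeDc gives one of size ≤ n²·dc(per_n) ≤
n²·2^((log₂ n + c)^c) ≤ 2^((log₂ n + c')^c') — contradiction; so dc(per_n) is not qp-bounded and
DcqpToVH yields ValiantsHypothesis. The
cruxes feed X through the ladder ExcessRankUnbounded ⇐ BoundedRankImpossible, TotalRankSuperlinear,
BorderBoundedRank (all necessary
consequences of X morally, by Heredity), not through the assembly term.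

Rationale: WHY THIS LINE. The normal form trades the two parameters of a determinantal expression (size m,
affine part A₀) for a single matrix K and a colouring κ,
and turns per-versus-det into a FIBRE-SUM problem for the principal minor map K ↦ (det K_S)_S, an
object with its own mature theory that no
dc lower bound has used: hyperdeterminantal / Rayleigh-difference relations on the image
(HoltzSturmfels2007, LinSturmfels2009, Oeding2011,
AlahmadiehVinzant2024 Thm 3.1 + Main Result 4), fibres = diagonal similarity and transpose
(HartfielLoewy1984, GriffinTsatsomeros2006,
AravindEtAl2026), and for coloured blocks the gauge group Π_e GL(κ⁻¹e) with its quiver invariants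
(traces of block cycles). In this measure the
Mignon–Ressayre Hessian bound (n²/2) is BELOW the trivial bound n², so even the first rungs (total
rank ≥ n² + 2; no expression with all
coefficient ranks ≤ 2 — the open problems of AravindJoglekar2015 §5 and IkenmeyerLandsberg2017 §2,
where rank 1 is settled by IL17 Thm 2.9 +
Vonzurgathen1987 regularity) force an invariant that separates per_n from det_n at equal n (det_n is
read-once), which flattening ranks cannot
be (PartialDerivativesDetPerm). Imported area: linear-algebraic geometry of principal minors /
determinantal point-process kernels and
invariant theory of quiver representations (closure of gauge orbits) — used for the border crux,
where 'certificate' means an equation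
vanishing on the closure of the aggregated image. Prior routes: DetQP attacks dc by hypersurface
invariants and LR17 symmetrisation, GCTMult /
IntegralGCT by orbit closures of det_m; none fixes the variety (principal-minor image of ONE matrix)
and varies only a colouring. Negatives
index: empty at filing.

RANKED CRUXES. #0 TotalRankNotQP (target) — X: for every c there is an n such that per_n(x+J) ≠
n!·det(I_R + diag(x∘κ)·K) for all R ≤ 2^((log₂ n + c)^c), all K ∈ ℂ^(R×R) and all colourings κ : [R]
→ [n]² (pmc(per_n) = minimal total rank of a determinantal expression is not qp-bounded). (why it
might fail: Equivalent to DetQP.DetqpThesis = extended Valiant hypothesis VNP ⊄ VQP at k = ℂ (BCS97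
(21.41), open): false if dc(per_n) = n^O(log n), which is compatible with VP ≠ VNP; known window
n²+1 ≤ pmc(per_n) ≤ n·2^(n−1).) [BurgisserClausenShokrollahi1997, IkenmeyerLandsberg2017,
Grenet2011, MignonRessayre2004, AravindJoglekar2015]
#2 TotalRankSuperlinear (crux) — super-linear total rank: there are ε > 0 and n₀ such that for n ≥
n₀ every principal-minor representation per_n(x+J) = n!·det(I_R + diag(x∘κ)K) has R ≥ n^(2+ε); i.e.
a determinantal expression of per_n needs average coefficient rank n^ε per variable (card Crux1,
first quantitative rung). [difficulty: open-problem] (why it might fail: Nothing beyond pmc ≥ n²+1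
is known; the Hessian/dual-variety engines give n²/2 < trivial; pmc could be O(n²) (e.g. if
dc(per_n) = O(n) fails but rank-O(1)-on-average expressions of large size exist); needs an invariant
separating per_n from det_n (pmc(det_n) = n²).) [IkenmeyerLandsberg2017, MignonRessayre2004,
AlperBogartVelasco2017, Landsberg2017,
Literature.Barriers.ValiantsHypothesis.PartialDerivativesDetPerm]
#3 BoundedRankImpossible (crux) — for every r there is n₀ such that for n ≥ n₀ no principal-minor
representation of per_n(x+J)/n! has all colour classes of size ≤ r; equivalently per_n has no affine
determinantal expression, of any size, whose coefficient matrices A_e all have rank ≤ r (r = 1: IL17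
Thm 2.9 with von zur Gathen regularity, n₀ = 3; r ≥ 2 open, AJ15 §5 'even k = 2 might be
challenging'). [difficulty: L] (why it might fail: Small n ARE low-rank expressible (Grenet: max
rank C(n−1,⌊(n−1)/2⌋); per_3 is rank-2); a uniform rank-r construction for all n, any size, gives
dc(per_n) ≤ r·n² and refutes VH itself; IL17's degree-3 bookkeeping (Lemmas 6.3–6.4) has no known
extension to r = 2.) [IkenmeyerLandsberg2017, Vonzurgathen1987, AravindJoglekar2015, Grenet2011]
#4 BorderBoundedRank (crux) — certificate (border) form of BoundedRankImpossible: for every r and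
large n, for every colouring κ with classes ≤ r, the coefficient vector of per_n(x+J) is not even in
the CLOSURE of the set of coefficient vectors of n!·det(I_R + diag(x∘κ)K), K ∈ ℂ^(R×R); equivalently
some polynomial relation valid on the κ-aggregated principal-minor image (hyperdeterminantal /
Rayleigh–Dodgson type) fails at per_n (card Crux2 made precise at the first rung). [deps:
BoundedRankImpossible] [difficulty: L] (why it might fail: The principal-minor image is not closed
(LinSturmfels2009) and has no finite SL₂ⁿ⋊S_n equation set for all n (AlahmadiehVinzant2024 Main
Result 4); for r ≥ 2 gauge orbits of Π GL_r may diverge with convergent aggregated minors, so per_n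
could be border-rank-r yet not rank-r (r = 1 is safe).) [LinSturmfels2009, AlahmadiehVinzant2024,
HoltzSturmfels2007, Oeding2011, IkenmeyerLandsberg2017,
Literature.Barriers.ValiantsHypothesis.AlgebraicNaturalProofs]
#9 NormalForm (support) — Sylvester normal form (provable now): an affine determinantal
representation A of per_n of size m yields K ∈ ℂ^(R×R) and κ with per_n(x+J) = n!·det(I_R +
diag(x∘κ)K) and R ≤ Σ_e rank(coefficient matrix of x_e in A) — shift to J, factor A(J)⁻¹A_e through
its column space, apply Matrix.det_one_add_mul_comm. [difficulty: provable-now]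
[IkenmeyerLandsberg2017, AravindJoglekar2015, AravindEtAl2026, Mathlib Matrix.det_one_add_mul_comm]
#9 PMReprIsDetRepr (support) — converse bookkeeping (provable now): a principal-minor representation
of size R is an affine determinantal representation of per_n of size R (substitute x = y − J, absorb
n! into one row); hence dc(per_n) ≤ pmc(per_n), X ⇐ DetQP.DetqpThesis and TotalRankSuperlinear ⇐
DetQP.DetqpSuperquadratic. [difficulty: provable-now] [MignonRessayre2004, Burgisser2000]
#9 Heredity (support) — heredity / conditioning (provable now; the usable content of
read-rank-conditioning E1 and of IL17 Lemma 6.2): freezing row and column n+1 of x at the pattern of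
J (Schur complement by the frozen block, invertible because per_n(J) ≠ 0) turns a representation of
per_(n+1) with classes ≤ r into one of per_n with classes ≤ r and no larger size; so pmc and every
rung are monotone in n. [difficulty: provable-now] [IkenmeyerLandsberg2017, AravindJoglekar2015]
#9 RankTwoImpossible (support) — first open special case of BoundedRankImpossible (AJ15 §5: 'even
the simplest case k = 2 might be challenging'): for large n, per_n has no determinantal expression
with all coefficient matrices of rank ≤ 2 (per_3 has one: Grenet's 7×7 has ranks 1,2,1 by rows, so
n₀ ≥ 4). [difficulty: L] [AravindJoglekar2015, IkenmeyerLandsberg2017, Grenet2011]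
#9 ExcessRankUnbounded (support) — weakest open rung: the excess pmc(per_n) − n² is unbounded (for
every k and large n no representation of size ≤ n² + k); IL17 gives excess ≥ 1 for n ≥ 3, excess ≥ 2
('all coefficient matrices rank one except one of rank two is impossible') is already open; implied
by BoundedRankImpossible (size ≤ n²+k forces classes ≤ k+1). [difficulty: M]
[IkenmeyerLandsberg2017, AravindJoglekar2015]
#9 TotalRankLeDc (support) — glue (provable now from NormalForm,
hasDetRepr_determinantalComplexity_holds and rank ≤ size): for every n there is a principal-minor
representation of per_n(x+J) of size ≤ n²·dc(per_n). [difficulty: provable-now] [MignonRessayre2004,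
Literature.Computability.AlgebraicComplexity.hasDetRepr_determinantalComplexity_holds]
#9 QpArith (support) — arithmetic glue (provable now): n² · 2^((log₂ n + c)^c) ≤ 2^((log₂ n +
c')^c') for c' = c + 2 and all n. [difficulty: provable-now] [Burgisser2000]
#9 DcqpToVH (support) — glue (provable now from PROVED cone facts): dc(per_n) not qp-bounded ⇒ VP ℂ
≠ VNP ℂ, composing isQPBounded_determinantalComplexity_of_isVPFamily_holds (VP ⊆ VQP =
qp-projections of DET, BCS97 (21.27)/(21.40)), mem_VP_ofFintype_iff_holds, perFamily_mem_VNP_holds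
and Hub.valiantsHypothesis_of_not_isVPFamily_per (Theorems/HubHub.lean); = route DetQP's Assembly
with its hypotheses discharged. [difficulty: provable-now] [BurgisserClausenShokrollahi1997,
Burgisser2000, Valiant1979,
Literature.Computability.AlgebraicComplexity.isQPBounded_determinantalComplexity_of_isVPFamily_holds]

TWO-LAYER PLAN. Foreseen glued splits (k ≤ 3, depth 1), filed only when a crux closes or stalls with
a census:
BoundedRankImpossible ⇐ RankBase(r) (a finite n₀(r) by certified computation / structure of kernels
K with prescribed aggregated minors of
order ≤ 4, cf. AravindEtAl2026 Thm 1.3) → Heredity → BoundedRankImpossible; BorderBoundedRank ⇐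
BoundedRankImpossible → GaugeProper (at targets
with all a_e a_e' − a_ee' ≠ 0 the aggregated principal-minor map is proper modulo Π GL_r: convergent
block-cycle traces bound the gauge orbit)
→ BorderBoundedRank; TotalRankSuperlinear ⇐ an invariant μ of coefficient vectors with
μ(κ-aggregated principal minors of a size-R matrix)
≤ R^C and μ(per_n(x+J)) ≥ n^(2C+δ) → TotalRankSuperlinear (candidates: dimension of the span of
Rayleigh differences Δ_ee'(f) and their
SL₂-orbit; number of independent Dodgson-type syzygies).

KILL CRITERIA. A rank-r determinantal expression of per_n for all large n and fixed r (refuting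
BoundedRankImpossible) gives dc(per_n) ≤ r·n² and refutes
X, DetQP and essentially VH-by-determinants: close `refuted:BoundedRankImpossible`. A proof that
per_n is border-rank-r for bounded r while
BoundedRankImpossible stands kills only the certificate engine: drop BorderBoundedRank, keep the
ladder. dc(per_n) ≤ 2^polylog (refuting
DetqpThesis) closes the route with DetQP. Proof of DetQP.DetqpSuperquadratic elsewhere moots
TotalRankSuperlinear (PMReprIsDetRepr); proof
of DetqpThesis elsewhere moots the route (X is equivalent).

NOT DECOMPOSED YET. Which invariant μ drives TotalRankSuperlinear (layer 2); the base cases n₀(r)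
(certified computation: is per_4 rank-2 expressible? K ∈
ℂ^(32×32) modulo GL₂^16); the GIT/properness lemma behind BorderBoundedRank for r ≥ 2; symmetry
inheritance of minimal-total-rank
expressions (gauge-unique fibres ⇒ S_n×S_n-equivariance; the torus does not fix J, so LR17 Thm 2.8
does not apply verbatim — left to card
rigid-minimal-detreps-inherit-symmetry); positivity/stability exclusions (Hermitian K impossible
since per_n(x+J) is not real stable) are
class-wise remarks, not items. No third layer will be filed; lemmas ride with --supports.

CHEAPEST FALSIFIER. (1) Lookup, done this session: is rank 1 really closed over ℂ? Yes — IL17 Thm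
2.9 is stated for REGULAR expressions, and IL17 p.4 /
Vonzurgathen1987 make every determinantal expression of per_m (m ≥ 3) regular (singular locus of
codim ≥ 5), so the ladder genuinely starts
at r = 2 / excess 2. (2) Certified numerics a refuter can run first: solve for K ∈ ℂ^(32×32), κ =
each cell twice, with per_4(x+J) =
24·det(I + diag(x∘κ)K) (65 536 aggregated-minor equations, 1024 unknowns modulo GL₂^16) by
Newton/homotopy from Grenet-type seeds; a solution
for n = 4, 5, 6 with a visible pattern would threaten RankTwoImpossible and BoundedRankImpossible;
infeasibility certificates (Nullstellensatz
degree) for n = 4 are the first data point for the certificate engine. (3) pmc(per_3) ∈ {10, 11, 12}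
exactly (dc(per_3) = 7 is known): a
Gröbner/numerical computation; 12 (= Grenet) would support 'Grenet is total-rank optimal'.

NUMBERS. Trivial: pmc(f) ≥ #variables, so pmc(per_n) ≥ n²; pmc(det_n) = n² (det_n = det(X) is
read-once). IL17 Thm 2.9 + vzG87: pmc(per_n) ≥ n² + 1
(n ≥ 3). Grenet2011: per_n = det of a (2^n − 1)-matrix whose coefficient matrix of x_ij is a partial
permutation matrix of rank C(n−1, i−1),
so pmc(per_n) ≤ Σ_ij C(n−1,i−1) = n·2^(n−1) (n = 3: 10 ≤ pmc ≤ 12, while dc(per_3) = 7,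
AlperBogartVelasco2017). Ryser: read-2^(n−1)
(AJ15). dc window: n²/2 ≤ dc(per_n) ≤ 2^n − 1 (MignonRessayre2004, Grenet2011); dc ≤ pmc ≤ n²·dc.
AJ15 Thm 2: per_n not read-once over ℝ
and over F_q with −3 a non-residue, n > 5; read-k ⇒ dc ≤ k·n² (AJ15 Thm 1); rank-k size s ⇒ read-k
size s + 2n²k (Anderson–Shpilka–Volk, IL17
Rem 2.10). LR17: equivariant dc = C(2n,n) − 1. Items at open: 13 (1 target, 3 cruxes, 8 support, 1
assembly).

DEFINITION REQUESTS. - `HasPrincipalMinorRepr (f : MvPolynomial σ k) (R : ℕ)` /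
`principalMinorComplexity f` (topic Literature/Computability/AlgebraicComplexity,
next to HasDetRepr): ∃ K : Matrix (Fin R) (Fin R) k, ∃ κ : Fin R → σ, f = C (f(0)-normalisation) *
det (1 + diagonal (X ∘ κ) * K.map C);
pmc = sInf. The items inline this for f = per_n(x+J)/n!; once the definition lands the cruxes can be
restated over it (no meaning change).
- cite fact wanted: IkenmeyerLandsberg2017 Thm 2.9 + Vonzurgathen1987 ('per_m, m ≥ 3, has no
rank-one determinantal expression over ℂ') as
a named Literature fact — it is BoundedRankImpossible at r = 1 and the base of Heredity inductions.

Novelty: Searches (2026-08-15): `lit search --source zbmath "read-once determinant permanent"` (4: AJ15,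
Arvind–Raja 2016, JQS10), `… "rank one
determinantal expression permanent"` (1: IL17), `… "principal minor assignment problem"` (11:
HoltzSturmfels2007, GriffinTsatsomeros2006,
Rising–Kulesza–Taskar 2015, Brunel–Urschel 2024, arXiv:2603.04255 = AravindEtAl2026), `lit galaxy
search "read-once determinant" --star all`
(1 panama hit: the FCT 2015 volume of AJ15; pdf/crabby stars timed out), `lit frontier
ValiantsHypothesis --since 2022` (30 rows; relevant:
arXiv:2604.28019 symmetrized determinant — unrelated on reading; Bedi–Suagee 2026 degree-2 bound),
`lit search --source crossref` (noise);
OpenAlex/S2/arXiv APIs rate-limited (429) at search time; pages read: AJ15 pp.3,5,11–12; IL17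
pp.4–5,10–11; AAV24 pp.4,7,14–15; AravindEtAl2026
pp.2–9.
Nearest prior art found: AravindJoglekar2015 (read-k determinants; Thm 1 dc ≤ nk; per not ROD over
ℝ/F_q; §5 poses read-k, k ≥ 2 and the
rank-one model as open), IkenmeyerLandsberg2017 (Def 2.8 rank-k expressions; Thm 2.9 rank one
impossible over ℂ; Rem 2.10 ASV), AravindEtAl2026
(the same Sylvester step rank-one symbolic determinant ↔ principal-minor polynomial, for LEARNING, r
= 1 only), AlahmadiehVinzant2024 /
LinSturmfels2009 / HoltzSturmfels2007 / Oeding2011 (equations and non-equations of the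
principal-minor image, static case κ = id),
HartfielLoewy1984 (fibres). No source defines total rank Σ_e rank A_e as a complexity measure,
proves any b  [refs: 2603.04255, 2604.28019, HoltzSturmfels2007, GriffinTsatsomeros2006, AravindEtAl2026, AravindJoglekar2015, IkenmeyerLandsberg2017, AlahmadiehVinzant2024, LinSturmfels2009, Oeding2011, HartfielLoewy1984]

Barriers (technique_class: principal-minor-map, total-rank, gauge-closure): - technique_class: principal-minor-map, total-rank, gauge-closure
- Literature.Barriers.ValiantsHypothesis.PartialDerivativesDetPerm: evaded by construction and used
as a design constraint — flattening / partial-derivative ranks coincide for per_n and det_n, and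
pmc(det_n) = n² is the trivial value, so any invariant proving TotalRankSuperlinear must separate
per_n from det_n at the same n; ranks of linear images of f are never evaluated.
- Literature.Barriers.ValiantsHypothesis.ShiftedPartialsCannotSeparate / UnpaddedShiftedPartials /
RankMethods / RankLifting: not engaged — no shifted-partials, tensor-rank or Waring-rank
certification and no padding (the normal form is affine and size-free); the sub-multiplicativity
ceilings they formalise do not speak about aggregated principal minors.
- Literature.Barriers.ValiantsHypothesis.AlgebraicNaturalProofs (conditional on succinct hitting
sets for VP): APPLIES to the certificate crux BorderBoundedRank in spirit — an equation vanishing on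
the closure of the rank-r aggregated image is a distinguisher for a slice of VBP; evasion only in
that nothing requires these equations to be VP-computable (LinSturmfels2009: degree 12 already for
4×4, r = 1) and that BoundedRankImpossible / TotalRankSuperlinear need not be equation-based at all
(IL17's r = 1 proof is support combinatorics). Honest bet, flagged on the item.
- Literature.Barriers.ValiantsHypothesis.PermanentCharTwo: consistent and load-bearing — the normal
form is characteristic-fre

History (route lifecycle, newest last):
- 2026-08-16T04:21:39Z · AUTO-CRUX (backfill): TotalRankNotQP — hypotheses of the deciding theorem that nothing in the route derives are cruxes (operator:999:1085951)
- 2026-08-22T07:26:42Z · DORMANT — reconciler: no traction for 5.2 d (last activity statement-grounded at 2026-08-17T02:50:14Z); parked, not closed — `ledger route dormant route-ValiantsHypothesi (operator:999:1810957)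
- 2026-08-26T06:36:50Z · REACTIVATED — reconciler: reactivated — activity item-proof-filed at 2026-08-26T05:36:26Z after parking at 2026-08-22T07:26:42Z (operator:999:626960)

sub-problem: ValiantsHypothesis · status: open · opened planner-plancard-ValiantsHypothesis-ValiantsH-77127ebb-0 2026-08-15T11:24:07Z · rev 6 · ledger route-ValiantsHypothesis-PrincipalMinorColouring
GENERATED by the gate from the ledger (D-0016/17). Provers cite these decls: `theorem foo : Summit.ValiantsHypothesis.ValiantsHypothesis.Theses.PrincipalMinorColouring.<Decl> := …` in Summits/ValiantsHypothesis/ValiantsHypothesis/Theorems/<Name>.lean.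
-/

namespace Summit.ValiantsHypothesis.ValiantsHypothesis.Theses.PrincipalMinorColouring

open scoped BigOperators Topology Manifold Classical MeasureTheory ProbabilityTheory Matrix InnerProductSpace ComplexConjugate ContinuousMap
open Filter Set Function TopologicalSpace MeasureTheory

attribute [summit_statement] _root_.ValiantsHypothesis

open Literature.PNP

/-- item stmt-ValiantsHypothesis-3775 · crux (kind.auto-crux: conjecture-grade) · rank 0 · open · by planner
why it might fail: Equivalent to DetQP.DetqpThesis = extended Valiant hypothesis VNP ⊄ VQP at k = ℂ (BCS97 (21.41), open): false if dc(per_n) = n^O(log n), which is compatible with VP ≠ VNP; known window n²+1 ≤ pmc(per_n) ≤ n·2^(n−1).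
sources: BurgisserClausenShokrollahi1997, IkenmeyerLandsberg2017, Grenet2011, MignonRessayre2004, AravindJoglekar2015
[target] X: for every c there is an n such that per_n(x+J) ≠ n!·det(I_R + diag(x∘κ)·K) for all R ≤
2^((log₂ n + c)^c), all K ∈ ℂ^(R×R) and all colourings κ : [R] → [n]² (pmc(per_n) = minimal total
rank of a determinantal expression is not qp-bounded). -/
@[route_item "route-ValiantsHypothesis-PrincipalMinorColouring"]
def TotalRankNotQP : Prop :=
  ∀ c : ℕ, ∃ n : ℕ, ∀ R ≤ 2 ^ ((Nat.log 2 n + c) ^ c), ¬ ∃ (K : Matrix (Fin R) (Fin R) ℂ) (κ : Fin R → Fin n × Fin n), MvPolynomial.aeval (fun e => MvPolynomial.X e + 1) (Literature.Computability.AlgebraicComplexity.perPoly (Fin n) ℂ) = MvPolynomial.C (n.factorial : ℂ) * (1 + Matrix.diagonal (fun i => MvPolynomial.X (κ i)) * K.map (fun a : ℂ => (MvPolynomial.C a : MvPolynomial (Fin n × Fin n) ℂ))).det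

/-- item stmt-ValiantsHypothesis-18048 · crux · rank 2 · open · by planner
why it might fail: Constants may help at intermediate scales: dc_ℂ(per_n) could be 2^{n^{o(1)}} via transcendental or high-degree algebraic constants while every τ(N·PER_n) stays near 2^n; algebraic points on det-repr varieties have degree m^{O(m²n²)} generically; known eliminations work only mod p or under GRH.
sources: Burgisser2000 §4.1, Thm 4.5, Koiran2004 Thm 4.3, Koiran2005, arXiv:2606.25121 §1.2 (VP_C≠VNP_C ⇒ VP⁰≠VNP⁰ trivial, converse unclear), arXiv:2601.00387 §2.1, Grenet2011
[crux] scale-wise CONSTANT ELIMINATION for determinantal representations of per_n, up to an integer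
multiplier, at quasi-polynomial cost: one exponent a such that for all n, m an affine determinantal
representation of per_n of size m over ℂ yields N ≠ 0 in ℤ and a sign-constant ({0,±1} constants,
fan-in 2) circuit for N·PER_n over ℤ of size ≤ 2^((log₂ m + a)^a). The qp/determinantal form of the
constant gap TauConst.TauConstElim (stmt-ValiantsHypothesis-0335); content exactly at scales qp(n) <
m < 2^{n^{o(1)}} (vacuous below dc_ℂ, Ryser/Grenet-integral above); implied by weakly-exponential
hardness of dc_ℂ(per_n), implies nothing about VH by itself. Engine (skeleton
Cruxes/TotalRankNotQP/Lines/ConstantEliminationQP_birth.lean): Nullstellensatz descent ℂ→ℚ̄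
(provable) + qp-DEGREE algebraic points on the qp-padded representation variety (the bet;
GaugeDescent's torus-orbit/Hilbert-90 descent is the candidate mechanism) + restriction of scalars
on Berkowitz's circuit with denominators into N (provable). Must not use uniqueness of optimal
representations (refuted: GrenetRigidityOptimalUnique_refuted). (why it might fail: Constants may
help at intermediate scales: dc_ℂ(per_n) could be 2 -/
@[route_item "route-ValiantsHypothesis-PrincipalMinorColouring", crux]
def ConstantEliminationQP : Prop :=
  ∃ a : ℕ, ∀ n m : ℕ, Literature.Computability.AlgebraicComplexity.HasDetRepr (Literature.Computability.AlgebraicComplexity.perPoly (Fin n) ℂ) m → ∃ N : ℤ, N ≠ 0 ∧ Literature.Computability.AlgebraicComplexity.constantFreeComplexity (MvPolynomial.C N * Literature.Computability.AlgebraicComplexity.perPoly (Fin n) ℤ) ≤ 2 ^ ((Nat.log 2 m + a) ^ a)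

/-- item stmt-ValiantsHypothesis-18063 · crux · rank 3 · open · by planner
why it might fail: False iff some nonzero multiples N_n·PER_n have sign-constant circuits of size 2^{polylog n}: open; that would give PP ⊆ SIZE(2^polylog) GRH-free and contradict the Shub–Smale τ-conjecture (Bürgisser 2009 at qp scale); unconditionally only trivial bounds on τ(PER_n) are known.
sources: Burgisser2009 Main Thm 1.2, Lemma 2.12, Thm 4.1(2), ShubSmale1995 §1, Koiran2004 Thm 4.3, arXiv:2601.00387 §2.1 ('divisions by two occur'), arXiv:2606.25121 §1.2, BurgisserClausenShokrollahi1997 (21.41) extended Valiant hypothesis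
[crux] CONSTANT-FREE Extended Valiant Hypothesis, multiplier-tolerant: for every sequence of nonzero
integers N_n, n ↦ τ(N_n·PER_n) (constantFreeComplexity over ℤ: fan-in-2 {+,×}-circuits with
constants in {0,1,−1}) is not quasi-polynomially bounded. A consequence of TotalRankNotQP
(homogenise + VSBR + Valiant's formula→det, divide one row by N_n), strictly weaker as far as known
(no constant elimination). Two lines (skeleton
Cruxes/TotalRankNotQP/Lines/ConstantFreePerNotQP_birth.lean, endgame PROVED): Shub–Smale
τ-conjecture (= TauConst.TauConjecture, stmt-0336) + Bürgisser 2009 Main Thm 1.2 re-run at qp scale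
with multipliers (tree has the p-bounded version proved:
not_isPBounded_constantFreeComplexity_perPoly_of_shubSmaleTauConjecture); or the Boolean bet PP ⊄
SIZE(2^polylog) + the GRH-free transfer 'τ(N_n·PER_n) qp ⇒ PP ⊆ SIZE(2^polylog)' (Lemma 2.12 with
N_n inverted modulo an advice prime). (why it might fail: False iff some nonzero multiples N_n·PER_n
have sign-constant circuits of size 2^{polylog n}: open; that would give PP ⊆ SIZE(2^polylog)
GRH-free and contradict the Shub–Smale τ-conjecture (Bürgisser 2009 at qp scale); unconditionally
only trivial bounds on τ(PER_n) are -/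
@[route_item "route-ValiantsHypothesis-PrincipalMinorColouring", crux]
def ConstantFreePerNotQP : Prop :=
  ∀ N : ℕ → ℤ, (∀ n, N n ≠ 0) → ¬ Literature.Computability.AlgebraicComplexity.IsQPBounded (fun n => Literature.Computability.AlgebraicComplexity.constantFreeComplexity (MvPolynomial.C (N n) * Literature.Computability.AlgebraicComplexity.perPoly (Fin n) ℤ))

/-- item stmt-ValiantsHypothesis-3776 · banked · rank 2 · closed · proved by Summit.ValiantsHypothesis.ValiantsHypothesis.Theorems.PrincipalMinorColouring.totalRankSuperlinear_proof (prover) · by planner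
why it might fail: Nothing beyond pmc ≥ n²+1 is known; the Hessian/dual-variety engines give n²/2 < trivial; pmc could be O(n²) (e.g. if dc(per_n) = O(n) fails but rank-O(1)-on-average expressions of large size exist); needs an invariant separating per_n from det_n (pmc(det_n) = n²).
sources: IkenmeyerLandsberg2017, MignonRessayre2004, AlperBogartVelasco2017, Landsberg2017, Literature.Barriers.ValiantsHypothesis.PartialDerivativesDetPerm
[crux] super-linear total rank: there are ε > 0 and n₀ such that for n ≥ n₀ every principal-minor
representation per_n(x+J) = n!·det(I_R + diag(x∘κ)K) has R ≥ n^(2+ε); i.e. a determinantal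
expression of per_n needs average coefficient rank n^ε per variable (card Crux1, first quantitative
rung). [difficulty: open-problem] -/
@[route_item "route-ValiantsHypothesis-PrincipalMinorColouring"]
def TotalRankSuperlinear : Prop :=
  ∃ ε : ℝ, 0 < ε ∧ ∃ n₀ : ℕ, ∀ n ≥ n₀, ∀ (R : ℕ) (K : Matrix (Fin R) (Fin R) ℂ) (κ : Fin R → Fin n × Fin n), MvPolynomial.aeval (fun e => MvPolynomial.X e + 1) (Literature.Computability.AlgebraicComplexity.perPoly (Fin n) ℂ) = MvPolynomial.C (n.factorial : ℂ) * (1 + Matrix.diagonal (fun i => MvPolynomial.X (κ i)) * K.map (fun a : ℂ => (MvPolynomial.C a : MvPolynomial (Fin n × Fin n) ℂ))).det → (n : ℝ) ^ (2 + ε) ≤ R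

-- `TotalRankSuperlinear` holds: proved by `Summit.ValiantsHypothesis.ValiantsHypothesis.Theorems.PrincipalMinorColouring.totalRankSuperlinear_proof` (its module imports this route file, so no `_holds` link can be stated here).

/-- item stmt-ValiantsHypothesis-3777 · banked · rank 3 · closed · proved by Summit.ValiantsHypothesis.ValiantsHypothesis.Theorems.boundedRankImpossible_proof @ 60918d15ae8d (prover) · by planner
why it might fail: Small n ARE low-rank expressible (Grenet: max rank C(n−1,⌊(n−1)/2⌋); per_3 is rank-2); a uniform rank-r construction for all n, any size, gives dc(per_n) ≤ r·n² and refutes VH itself; IL17's degree-3 bookkeeping (Lemmas 6.3–6.4) has no known extension to r = 2.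
sources: IkenmeyerLandsberg2017, Vonzurgathen1987, AravindJoglekar2015, Grenet2011
[crux] for every r there is n₀ such that for n ≥ n₀ no principal-minor representation of
per_n(x+J)/n! has all colour classes of size ≤ r; equivalently per_n has no affine determinantal
expression, of any size, whose coefficient matrices A_e all have rank ≤ r (r = 1: IL17 Thm 2.9 with
von zur Gathen regularity, n₀ = 3; r ≥ 2 open, AJ15 §5 'even k = 2 might be challenging').
[difficulty: L] -/
@[route_item "route-ValiantsHypothesis-PrincipalMinorColouring", crux]
def BoundedRankImpossible : Prop :=
  ∀ r : ℕ, ∃ n₀ : ℕ, ∀ n ≥ n₀, ∀ (R : ℕ) (K : Matrix (Fin R) (Fin R) ℂ) (κ : Fin R → Fin n × Fin n), (∀ e, (Finset.univ.filter (fun i => κ i = e)).card ≤ r) → MvPolynomial.aeval (fun e => MvPolynomial.X e + 1) (Literature.Computability.AlgebraicComplexity.perPoly (Fin n) ℂ) ≠ MvPolynomial.C (n.factorial : ℂ) * (1 + Matrix.diagonal (fun i => MvPolynomial.X (κ i)) * K.map (fun a : ℂ => (MvPolynomial.C a : MvPolynomial (Fin n × Fin n) ℂ))).det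

-- `BoundedRankImpossible` holds: proved by `Summit.ValiantsHypothesis.ValiantsHypothesis.Theorems.boundedRankImpossible_proof` @ 60918d15ae8d (its module imports this route file, so no `_holds` link can be stated here).

/-- item stmt-ValiantsHypothesis-3778 · aside · rank 4 · closed · proved by Summit.ValiantsHypothesis.ValiantsHypothesis.Theorems.borderBoundedRank_proof (prover) · by planner
why it might fail: The principal-minor image is not closed (LinSturmfels2009) and has no finite SL₂ⁿ⋊S_n equation set for all n (AlahmadiehVinzant2024 Main Result 4); for r ≥ 2 gauge orbits of Π GL_r may diverge with convergent aggregated minors, so per_n could be border-rank-r yet not rank-r (r = 1 is safe).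
sources: LinSturmfels2009, AlahmadiehVinzant2024, HoltzSturmfels2007, Oeding2011, IkenmeyerLandsberg2017, Literature.Barriers.ValiantsHypothesis.AlgebraicNaturalProofs
[crux] certificate (border) form of BoundedRankImpossible: for every r and large n, for every
colouring κ with classes ≤ r, the coefficient vector of per_n(x+J) is not even in the CLOSURE of the
set of coefficient vectors of n!·det(I_R + diag(x∘κ)K), K ∈ ℂ^(R×R); equivalently some polynomial
relation valid on the κ-aggregated principal-minor image (hyperdeterminantal / Rayleigh–Dodgson
type) fails at per_n (card Crux2 made precise at the first rung). [deps: BoundedRankImpossible]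
[difficulty: L] -/
@[route_item "route-ValiantsHypothesis-PrincipalMinorColouring"]
def BorderBoundedRank : Prop :=
  ∀ r : ℕ, ∃ n₀ : ℕ, ∀ n ≥ n₀, ∀ (R : ℕ) (κ : Fin R → Fin n × Fin n), (∀ e, (Finset.univ.filter (fun i => κ i = e)).card ≤ r) → (fun m : (Fin n × Fin n) →₀ ℕ => MvPolynomial.coeff m (MvPolynomial.aeval (fun e => MvPolynomial.X e + 1) (Literature.Computability.AlgebraicComplexity.perPoly (Fin n) ℂ))) ∉ closure (Set.range (fun K : Matrix (Fin R) (Fin R) ℂ => fun m : (Fin n × Fin n) →₀ ℕ => MvPolynomial.coeff m (MvPolynomial.C (n.factorial : ℂ) * (1 + Matrix.diagonal (fun i => MvPolynomial.X (κ i)) * K.map (fun a : ℂ => (MvPolynomial.C a : MvPolynomial (Fin n × Fin n) ℂ))).det)))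

-- `BorderBoundedRank` holds: proved by `Summit.ValiantsHypothesis.ValiantsHypothesis.Theorems.borderBoundedRank_proof` (its module imports this route file, so no `_holds` link can be stated here).

/-- item stmt-ValiantsHypothesis-18099 · support · rank 9 · closed · proved by Summit.ValiantsHypothesis.ValiantsHypothesis.Theorems.totalRankNotQPOfConstantsSeam_proof @ da006f863630 (prover) · by planner
[support] GLUE of the constants-seam split of the deciding crux TotalRankNotQP
(stmt-ValiantsHypothesis-3775): ConstantEliminationQP → ConstantFreePerNotQP → TotalRankNotQP.
PROVED sorry-free by the crux strategist (rc 0, axioms propext/Classical.choice/Quot.sound):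
Cruxes/TotalRankNotQP/Lines/constants-seam.lean = candidate Theorems file
PrincipalMinorColouringTotalRankNotQPSplit.lean attached as evidence (theorem
totalRankNotQP_of_subs; a prover lands it verbatim, planners cannot write Theorems/). Proof: if
every per_n(x+J) had a principal-minor representation of size R_n ≤ 2^((log₂ n + c)^c),
PMReprIsDetRepr (landed) gives dc_ℂ(per_n) ≤ R_n, ConstantEliminationQP gives N_n ≠ 0 with
τ(N_n·PER_n) ≤ 2^((log₂ R_n + a)^a) ≤ 2^((log₂ n + c')^c'), c' = (c+2)(a+1) (qp_exponent_comp);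
choosing N_n for all n contradicts ConstantFreePerNotQP. [difficulty: provable-now] [sources:
folklore; Burgisser2000 Def 2.26] -/
@[route_item "route-ValiantsHypothesis-PrincipalMinorColouring", crux]
def TotalRankNotQPOfConstantsSeam : Prop :=
  ConstantEliminationQP → ConstantFreePerNotQP → TotalRankNotQP

-- `TotalRankNotQPOfConstantsSeam` holds: proved by `Summit.ValiantsHypothesis.ValiantsHypothesis.Theorems.totalRankNotQPOfConstantsSeam_proof` @ da006f863630 (its module imports this route file, so no `_holds` link can be stated here).

/-- item stmt-ValiantsHypothesis-21038 · support · rank 9 · closed · proved by Summit.ValiantsHypothesis.ValiantsHypothesis.Theorems.BorderBoundedRankTwoClosureCounting.borderBoundedRankTwo_proof (prover) · by planner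
[support] T6 rung r = 2 of BorderBoundedRank (stmt-3778; tenure sweep TABLE row 35, director-valiant
g8 16:23:56Z) — BORDER rank-two impossibility: for large n and every colouring κ of the R slots with
colour classes of size ≤ 2, the coefficient vector of per_n(x+J) is not even in the CLOSURE of the
set of coefficient vectors of n!·det(I_R + diag(x∘κ)·K), K ∈ ℂ^{R×R} (the r := 2 instance of 3778
verbatim; exact versions RankTwoImpossible stmt-3782 ✓ and BoundedRankImpossible stmt-3777 ✓ are
landed). The intended certificate: an aggregated hyperdeterminantal / Rayleigh–Dodgson relation
valid on the κ-aggregated principal-minor image (Holtz–Sturmfels 2007, Oeding 2011 for the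
un-aggregated image) that fails at per_n(x+J). Why it might fail: the principal-minor image is not
closed (LinSturmfels2009) and closures of κ-AGGREGATED principal-minor images have no literature
(grounder g13-3; Alahmadieh–Vinzant 2024 is un-aggregated) — for r = 2 divergent gauge orbits of Π
GL_2 with convergent aggregated minors could put per_n in the border without a rank-2 expression;
difficulty L. Sources: HoltzSturmfels2007, Oeding2011, LinSturmfels2009, AlahmadiehVinzant2024,
IkenmeyerLandsberg2017. Elab -/
@[route_item "route-ValiantsHypothesis-PrincipalMinorColouring"]
def BorderBoundedRankTwo : Prop :=
  ∃ n₀ : ℕ, ∀ n ≥ n₀, ∀ (R : ℕ) (κ : Fin R → Fin n × Fin n), (∀ e, (Finset.univ.filter (fun i => κ i = e)).card ≤ 2) → (fun m : (Fin n × Fin n) →₀ ℕ => MvPolynomial.coeff m (MvPolynomial.aeval (fun e => MvPolynomial.X e + 1) (Literature.Computability.AlgebraicComplexity.perPoly (Fin n) ℂ))) ∉ closure (Set.range (fun K : Matrix (Fin R) (Fin R) ℂ => fun m : (Fin n × Fin n) →₀ ℕ => MvPolynomial.coeff m (MvPolynomial.C (n.factorial : ℂ) * (1 + Matrix.diagonal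 (fun i => MvPolynomial.X (κ i)) * K.map (fun a : ℂ => (MvPolynomial.C a : MvPolynomial (Fin n × Fin n) ℂ))).det)))

-- `BorderBoundedRankTwo` holds: proved by `Summit.ValiantsHypothesis.ValiantsHypothesis.Theorems.BorderBoundedRankTwoClosureCounting.borderBoundedRankTwo_proof` (its module imports this route file, so no `_holds` link can be stated here).

/-- item stmt-ValiantsHypothesis-23302 · support · rank 9 · open · by planner
[support] BORDER TOTAL-RANK LOWER BOUND — the border version of Hrubeš–Joglekar 2025 Thm. 7
(variable size Ω(n^{5/2}/log n); in the principal-minor colouring model every diagonal slot carries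
a variable, so variable size = total rank R): if, for a FIXED slot colouring κ : Fin R → [n]², the
coefficient function of per_n(x+J) lies in the closure (product topology) of the coefficient
functions of n!·det(1 + diag(x∘κ)·K), K ∈ ℂ^{R×R}, then R ≥ c·n^{5/2}/log n. Border upgrade of the
banked TotalRankSuperlinear (stmt-3776) exactly as BorderBoundedRank (stmt-3778, proved p579524)
upgraded BoundedRankImpossible (stmt-3777); expansion after 3778 (director-valiant g9
2026-08-27T22:47:57Z, tenure g7 I7). PLAN: HJ25 Thm 7's block decomposition is in tree
(Literature/…/ReadKDeterminantalRepresentationsProofs.lean: n·⌊n/k⌋ disjoint transversal blocks,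
`variableSize_ge_blocks`, `two_pow_le_of_block` 2^k ≤ 1 + 4·s_Z²) and s_Z = #{i : κ i ∈ Z} is read
off the fixed κ; the only new piece is the PER-BLOCK BORDER TRANSPORT = the 3778/21038 `transport`
lemma (Theorems/PrincipalMinorColouringBorderBoundedRankTransport.lean) localised to one transversal
block, composed with universality `exists_subst_per -/
@[route_item "route-ValiantsHypothesis-PrincipalMinorColouring"]
def BorderTotalRankSuperlinear : Prop :=
  ∃ c : ℝ, 0 < c ∧ ∃ n₀ : ℕ, ∀ n ≥ n₀, ∀ (R : ℕ) (κ : Fin R → Fin n × Fin n), (fun m : (Fin n × Fin n) →₀ ℕ => MvPolynomial.coeff m (MvPolynomial.aeval (fun e => MvPolynomial.X e + 1) (Literature.Computability.AlgebraicComplexity.perPoly (Fin n) ℂ))) ∈ closure (Set.range (fun K : Matrix (Fin R) (Fin R) ℂ => fun m : (Fin n × Fin n) →₀ ℕ => MvPolynomial.coeff m (MvPolynomial.C (n.factorial : ℂ) * (1 + Matrix.diagonal (fun i => MvPolynomial.X (κ i)) * K.map (fun a : ℂ => (MvPolynomial.C a : MvPolynomial (Fin n × Fin n) ℂ))).det)))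 → c * (n : ℝ) ^ ((5 : ℝ) / 2) / Real.log (n : ℝ) ≤ (R : ℝ)

/-- item stmt-ValiantsHypothesis-3779 · support · rank 9 · closed · proved by Summit.ValiantsHypothesis.Theorems.PrincipalMinorColouring.normalForm_proof @ e434a0a71209 (prover) · by planner
sources: IkenmeyerLandsberg2017, AravindJoglekar2015, AravindEtAl2026, Mathlib Matrix.det_one_add_mul_comm
[support] Sylvester normal form (provable now): an affine determinantal representation A of per_n of
size m yields K ∈ ℂ^(R×R) and κ with per_n(x+J) = n!·det(I_R + diag(x∘κ)K) and R ≤ Σ_e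
rank(coefficient matrix of x_e in A) — shift to J, factor A(J)⁻¹A_e through its column space, apply
Matrix.det_one_add_mul_comm. [difficulty: provable-now] -/
@[route_item "route-ValiantsHypothesis-PrincipalMinorColouring"]
def NormalForm : Prop :=
  ∀ (n m : ℕ) (A : Matrix (Fin m) (Fin m) (MvPolynomial (Fin n × Fin n) ℂ)), Literature.Computability.AlgebraicComplexity.IsAffineDetRepr (Literature.Computability.AlgebraicComplexity.perPoly (Fin n) ℂ) A → ∃ R ≤ ∑ e : Fin n × Fin n, (Matrix.of (fun i j => MvPolynomial.coeff (Finsupp.single e 1) (A i j))).rank, ∃ (K : Matrix (Fin R) (Fin R) ℂ) (κ : Fin R → Fin n × Fin n), MvPolynomial.aeval (fun e => MvPolynomial.X e + 1) (Literature.Computability.AlgebraicComplexity.perPoly (Fin n) ℂ) = MvPolynomial.C (n.factorial : ℂ) * (1 + Matrix.diagonal (fun i => MvPolynomial.X (κ i)) * K.map (fun a : ℂ => (MvPolynomial.C a : MvPolynomial (Fin n × Fin n) ℂ))).det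

-- `NormalForm` holds: proved by `Summit.ValiantsHypothesis.Theorems.PrincipalMinorColouring.normalForm_proof` @ e434a0a71209 (its module imports this route file, so no `_holds` link can be stated here).

/-- item stmt-ValiantsHypothesis-3780 · support · rank 9 · closed · proved by Summit.ValiantsHypothesis.ValiantsHypothesis.Theorems.pmReprIsDetRepr_proof @ 2d28f077352e (prover) · by planner
sources: MignonRessayre2004, Burgisser2000
[support] converse bookkeeping (provable now): a principal-minor representation of size R is an
affine determinantal representation of per_n of size R (substitute x = y − J, absorb n! into one
row); hence dc(per_n) ≤ pmc(per_n), X ⇐ DetQP.DetqpThesis and TotalRankSuperlinear ⇐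
DetQP.DetqpSuperquadratic. [difficulty: provable-now] -/
@[route_item "route-ValiantsHypothesis-PrincipalMinorColouring"]
def PMReprIsDetRepr : Prop :=
  ∀ (n R : ℕ) (K : Matrix (Fin R) (Fin R) ℂ) (κ : Fin R → Fin n × Fin n), MvPolynomial.aeval (fun e => MvPolynomial.X e + 1) (Literature.Computability.AlgebraicComplexity.perPoly (Fin n) ℂ) = MvPolynomial.C (n.factorial : ℂ) * (1 + Matrix.diagonal (fun i => MvPolynomial.X (κ i)) * K.map (fun a : ℂ => (MvPolynomial.C a : MvPolynomial (Fin n × Fin n) ℂ))).det → Literature.Computability.AlgebraicComplexity.HasDetRepr (Literature.Computability.AlgebraicComplexity.perPoly (Fin n) ℂ) R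

-- `PMReprIsDetRepr` holds: proved by `Summit.ValiantsHypothesis.ValiantsHypothesis.Theorems.pmReprIsDetRepr_proof` @ 2d28f077352e (its module imports this route file, so no `_holds` link can be stated here).

/-- item stmt-ValiantsHypothesis-3781 · support · rank 9 · closed · proved by Summit.ValiantsHypothesis.ValiantsHypothesis.Theorems.heredity_proof (prover) · by planner
sources: IkenmeyerLandsberg2017, AravindJoglekar2015
[support] heredity / conditioning (provable now; the usable content of read-rank-conditioning E1 and
of IL17 Lemma 6.2): freezing row and column n+1 of x at the pattern of J (Schur complement by the
frozen block, invertible because per_n(J) ≠ 0) turns a representation of per_(n+1) with classes ≤ r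
into one of per_n with classes ≤ r and no larger size; so pmc and every rung are monotone in n.
[difficulty: provable-now] -/
@[route_item "route-ValiantsHypothesis-PrincipalMinorColouring", crux]
def Heredity : Prop :=
  ∀ (n r R : ℕ) (K : Matrix (Fin R) (Fin R) ℂ) (κ : Fin R → Fin (n + 1) × Fin (n + 1)), (∀ e, (Finset.univ.filter (fun i => κ i = e)).card ≤ r) → MvPolynomial.aeval (fun e => MvPolynomial.X e + 1) (Literature.Computability.AlgebraicComplexity.perPoly (Fin (n + 1)) ℂ) = MvPolynomial.C ((n + 1).factorial : ℂ) * (1 + Matrix.diagonal (fun i => MvPolynomial.X (κ i)) * K.map (fun a : ℂ => (MvPolynomial.C a : MvPolynomial (Fin (n + 1) × Fin (n + 1)) ℂ))).det → ∃ R' ≤ R, ∃ (K' : Matrix (Fin R') (Fin R') ℂ) (κ' : Fin R' → Fin n × Fin n), (∀ e, (Finset.univ.filter (fun i => κ' i = e)).card ≤ r) ∧ MvPolynomial.aeval (fun e => MvPolynomial.X e + 1) (Literature.Computability.AlgebraicComplexity.perPoly (Fin n) ℂ) = MvPolynomial.C (n.factorial : ℂ) * (1 + Matrix.diagonal (fun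 i => MvPolynomial.X (κ' i)) * K'.map (fun a : ℂ => (MvPolynomial.C a : MvPolynomial (Fin n × Fin n) ℂ))).det

-- `Heredity` holds: proved by `Summit.ValiantsHypothesis.ValiantsHypothesis.Theorems.heredity_proof` (its module imports this route file, so no `_holds` link can be stated here).

/-- item stmt-ValiantsHypothesis-3782 · support · rank 9 · closed · proved by Summit.ValiantsHypothesis.ValiantsHypothesis.Theorems.rankTwoImpossible_proof @ 60918d15ae8d (prover) · by planner
sources: AravindJoglekar2015, IkenmeyerLandsberg2017, Grenet2011
[support] first open special case of BoundedRankImpossible (AJ15 §5: 'even the simplest case k = 2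
might be challenging'): for large n, per_n has no determinantal expression with all coefficient
matrices of rank ≤ 2 (per_3 has one: Grenet's 7×7 has ranks 1,2,1 by rows, so n₀ ≥ 4). [difficulty:
L] -/
@[route_item "route-ValiantsHypothesis-PrincipalMinorColouring"]
def RankTwoImpossible : Prop :=
  ∃ n₀ : ℕ, ∀ n ≥ n₀, ∀ (R : ℕ) (K : Matrix (Fin R) (Fin R) ℂ) (κ : Fin R → Fin n × Fin n), (∀ e, (Finset.univ.filter (fun i => κ i = e)).card ≤ 2) → MvPolynomial.aeval (fun e => MvPolynomial.X e + 1) (Literature.Computability.AlgebraicComplexity.perPoly (Fin n) ℂ) ≠ MvPolynomial.C (n.factorial : ℂ) * (1 + Matrix.diagonal (fun i => MvPolynomial.X (κ i)) * K.map (fun a : ℂ => (MvPolynomial.C a : MvPolynomial (Fin n × Fin n) ℂ))).det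

-- `RankTwoImpossible` holds: proved by `Summit.ValiantsHypothesis.ValiantsHypothesis.Theorems.rankTwoImpossible_proof` @ 60918d15ae8d (its module imports this route file, so no `_holds` link can be stated here).

/-- item stmt-ValiantsHypothesis-3783 · support · rank 9 · closed · proved by Summit.ValiantsHypothesis.ValiantsHypothesis.Theorems.PrincipalMinorColouring.excessRankUnbounded_proof (prover) · by planner
sources: IkenmeyerLandsberg2017, AravindJoglekar2015
[support] weakest open rung: the excess pmc(per_n) − n² is unbounded (for every k and large n no
representation of size ≤ n² + k); IL17 gives excess ≥ 1 for n ≥ 3, excess ≥ 2 ('all coefficient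
matrices rank one except one of rank two is impossible') is already open; implied by
BoundedRankImpossible (size ≤ n²+k forces classes ≤ k+1). [difficulty: M] -/
@[route_item "route-ValiantsHypothesis-PrincipalMinorColouring"]
def ExcessRankUnbounded : Prop :=
  ∀ k : ℕ, ∃ n₀ : ℕ, ∀ n ≥ n₀, ∀ R ≤ n ^ 2 + k, ¬ ∃ (K : Matrix (Fin R) (Fin R) ℂ) (κ : Fin R → Fin n × Fin n), MvPolynomial.aeval (fun e => MvPolynomial.X e + 1) (Literature.Computability.AlgebraicComplexity.perPoly (Fin n) ℂ) = MvPolynomial.C (n.factorial : ℂ) * (1 + Matrix.diagonal (fun i => MvPolynomial.X (κ i)) * K.map (fun a : ℂ => (MvPolynomial.C a : MvPolynomial (Fin n × Fin n) ℂ))).det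

-- `ExcessRankUnbounded` holds: proved by `Summit.ValiantsHypothesis.ValiantsHypothesis.Theorems.PrincipalMinorColouring.excessRankUnbounded_proof` (its module imports this route file, so no `_holds` link can be stated here).

/-- item stmt-ValiantsHypothesis-3784 · support · rank 9 · closed · proved by Summit.ValiantsHypothesis.ValiantsHypothesis.Theorems.PrincipalMinorColouring_TotalRankLeDc_proof @ 6c70fe169b17 (prover) · by planner
sources: MignonRessayre2004, Literature.Computability.AlgebraicComplexity.hasDetRepr_determinantalComplexity_holds
[support] glue (provable now from NormalForm, hasDetRepr_determinantalComplexity_holds and rank ≤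
size): for every n there is a principal-minor representation of per_n(x+J) of size ≤ n²·dc(per_n).
[difficulty: provable-now] -/
@[route_item "route-ValiantsHypothesis-PrincipalMinorColouring", crux]
def TotalRankLeDc : Prop :=
  ∀ n : ℕ, ∃ R ≤ n ^ 2 * Literature.Computability.AlgebraicComplexity.determinantalComplexity (Literature.Computability.AlgebraicComplexity.perPoly (Fin n) ℂ), ∃ (K : Matrix (Fin R) (Fin R) ℂ) (κ : Fin R → Fin n × Fin n), MvPolynomial.aeval (fun e => MvPolynomial.X e + 1) (Literature.Computability.AlgebraicComplexity.perPoly (Fin n) ℂ) = MvPolynomial.C (n.factorial : ℂ) * (1 + Matrix.diagonal (fun i => MvPolynomial.X (κ i)) * K.map (fun a : ℂ => (MvPolynomial.C a : MvPolynomial (Fin n × Fin n) ℂ))).det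

-- `TotalRankLeDc` holds: proved by `Summit.ValiantsHypothesis.ValiantsHypothesis.Theorems.PrincipalMinorColouring_TotalRankLeDc_proof` @ 6c70fe169b17 (its module imports this route file, so no `_holds` link can be stated here).

/-- item stmt-ValiantsHypothesis-3785 · support · rank 9 · closed · proved by Summit.ValiantsHypothesis.ValiantsHypothesis.Theorems.qpArith_proof (prover) · by planner
sources: Burgisser2000
[support] arithmetic glue (provable now): n² · 2^((log₂ n + c)^c) ≤ 2^((log₂ n + c')^c') for c' = c
+ 2 and all n. [difficulty: provable-now] -/
@[route_item "route-ValiantsHypothesis-PrincipalMinorColouring", crux]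
def QpArith : Prop :=
  ∀ c : ℕ, ∃ c' : ℕ, ∀ n : ℕ, n ^ 2 * 2 ^ ((Nat.log 2 n + c) ^ c) ≤ 2 ^ ((Nat.log 2 n + c') ^ c')

-- `QpArith` holds: proved by `Summit.ValiantsHypothesis.ValiantsHypothesis.Theorems.qpArith_proof` (its module imports this route file, so no `_holds` link can be stated here).

/-- item stmt-ValiantsHypothesis-3786 · support · rank 9 · closed · proved by Summit.ValiantsHypothesis.Theorems.dcqpToVH_proof_detQP @ aa57966d6490 (prover) · by planner
sources: BurgisserClausenShokrollahi1997, Burgisser2000, Valiant1979, Literature.Computability.AlgebraicComplexity.isQPBounded_determinantalComplexity_of_isVPFamily_holds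
[support] glue (provable now from PROVED cone facts): dc(per_n) not qp-bounded ⇒ VP ℂ ≠ VNP ℂ,
composing isQPBounded_determinantalComplexity_of_isVPFamily_holds (VP ⊆ VQP = qp-projections of DET,
BCS97 (21.27)/(21.40)), mem_VP_ofFintype_iff_holds, perFamily_mem_VNP_holds and
Hub.valiantsHypothesis_of_not_isVPFamily_per (Theorems/HubHub.lean); = route DetQP's Assembly with
its hypotheses discharged. [difficulty: provable-now] -/
@[route_item "route-ValiantsHypothesis-PrincipalMinorColouring", crux]
def DcqpToVH : Prop :=
  ¬ Literature.Computability.AlgebraicComplexity.IsQPBounded (fun n => Literature.Computability.AlgebraicComplexity.determinantalComplexity (Literature.Computability.AlgebraicComplexity.perPoly (Fin n) ℂ)) → ValiantsHypothesis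

-- `DcqpToVH` holds: proved by `Summit.ValiantsHypothesis.Theorems.dcqpToVH_proof_detQP` @ aa57966d6490 (its module imports this route file, so no `_holds` link can be stated here).

/-- item stmt-ValiantsHypothesis-3787 · assembly · rank 1 · closed · proved by Summit.ValiantsHypothesis.ValiantsHypothesis.Theorems.PrincipalMinorColouring.assembly_proof @ 55f036205b6f (prover) · by planner
sources: BurgisserClausenShokrollahi1997, Burgisser2000
[assembly] TotalRankNotQP → TotalRankLeDc → QpArith → DcqpToVH → ValiantsHypothesis. -/
@[route_item "route-ValiantsHypothesis-PrincipalMinorColouring"]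
def Assembly : Prop :=
  TotalRankNotQP → TotalRankLeDc → QpArith → DcqpToVH → ValiantsHypothesis

-- `Assembly` holds: proved by `Summit.ValiantsHypothesis.ValiantsHypothesis.Theorems.PrincipalMinorColouring.assembly_proof` @ 55f036205b6f (its module imports this route file, so no `_holds` link can be stated here).

/-! D-0027 §2.1 — DECIDING THEOREM (planner-authored via `route open/edit --closes-file`; by planner-cstrat-stmt-ValiantsHypothesis-3775-r1-0 2026-08-17T02:24:41Z):
its hypotheses are this route's items and its conclusion the sub-problem Statement (glue_lint), and it elaborates with this file. -/

@[closes "route-ValiantsHypothesis-PrincipalMinorColouring"] theorem closes (h_ConstantEliminationQP : ConstantEliminationQP)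
    (h_ConstantFreePerNotQP : ConstantFreePerNotQP)
    (h_TotalRankNotQPOfConstantsSeam : TotalRankNotQPOfConstantsSeam)
    (h_TotalRankLeDc : TotalRankLeDc) (h_QpArith : QpArith) (h_DcqpToVH : DcqpToVH) :
    _root_.ValiantsHypothesis := by
  -- the deciding crux `TotalRankNotQP` is DERIVED from the two pieces of the constants seam
  have h_TotalRankNotQP : TotalRankNotQP :=
    h_TotalRankNotQPOfConstantsSeam h_ConstantEliminationQP h_ConstantFreePerNotQP
  refine h_DcqpToVH ?_
  rintro ⟨c, hc⟩
  obtain ⟨c', hc'⟩ := h_QpArith c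
  obtain ⟨n, hn⟩ := h_TotalRankNotQP c'
  obtain ⟨R, hR, K, κ, hrepr⟩ := h_TotalRankLeDc n
  exact hn R (hR.trans ((Nat.mul_le_mul_left (n ^ 2) (hc n)).trans (hc' n))) ⟨K, κ, hrepr⟩

end Summit.ValiantsHypothesis.ValiantsHypothesis.Theses.PrincipalMinorColouring
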